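import Summits.QuantumFields.BalabanUV.Beta.GAN24.TaylorMassVH

/-!
# `BalabanUV.Beta.GAN24.TaylorMassVHPush` — binder row G-an2-4 / (CONV-C), S-slot, road «S3-Taylor» (gan24-p1 `SKELETON-S3.md` v1.0 §12.7∕§14.2):
# generic leaf **VH1**, part 2 — THE PUSH of a multiplier leg through `L` further blockings (`BalabanCompositeJets.pushSum M L`): the fibre of an
# old coarse point under the straight contours of the `L`-blocks has AT MOST `L` elements, hence the multiplier-leg ℓ¹ MASS of a pushed kernel at a
# fixed field site is at most `L` times that of the kernel; applied to an2's border increment: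
# `Σ_y |pushSum (M·Lc) L (borderInc d Lc M κ u) x y (inl α) (inr μ)| ≤ L · (2R_V+1)^{d+1} · M · 3ℓ² ∕ M^{d+1}` — the «path length» factor `L = N∕(M·Lc)`
# of the owner's §12.5 count, DISPLAYED.

Engine of the idle leaf seat `b2b-balaban-gan24-formalise-leaf-11` (gen 14); row owner gan24-p1-g4 RULINGS-5∕-6 (journal l.4559 ∕ l.4599) «VH1
`GAN24/TaylorMassVH` next, same pattern» — part 1 is `GAN24/TaylorMassVH` (table, lift, border increment), this is part 2.  NOT IN PRINT; OUR BOOKKEEPING.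
HONEST FRAMING (cell contract, verbatim): «discharging `BetaPertH` makes Bałaban's UV stability UNCONDITIONAL — a real constructive-QFT result; it is NOT
the continuum limit and NOT the Clay problem.»  HONEST DEPENDENCY (verbatim): «continuum YM on T⁴ ⇐ BetaPertH ∧ nine spine estimates (0/9 proved); BetaPertH
⇐ (D1) ∧ (D4) ∧ CAP+tail; G-an2-4 gates asym, D1 and NE2/3/4.»  [folklore] finite combinatorics of an2's `pushSum`∕`pushSet`∕`pushPt`∕`pushInd` and
an4's leg sets BY NAME (`GAN24/TaylorMassLam.card_filter_proj_legOff_le` is the fibre lemma); cites nothing, mints no `def … : Prop`, estimates NO resolvent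
leg, DISCHARGES NOTHING of rows V0∕V, of «E3Shape»∕«E3SupRate», of (hS, hSall) or of BetaPertH.  NOT continuum, NOT Clay.

## What is proved ([folklore], `0 sorry`; generic `d`, every `M, L ≥ 1`)
§1 `pushSum_inl_inr_coarse_sum` ∕ `pushSum_inr_inl_coarse_sum` (the pushed multiplier leg at a new coarse point as the `LegIdx d L`-sum over the
   block's straight contours, fine form of `PushSumNest.pushSum_inl_inr_coarse`), `legPt_eq_iff`, **`card_filter_legPt_eq_le`** (`#{i′ ∈ LegIdx d L :
   legPt L (inl μ) W′ i′ = p} ≤ L`), `abs_pushSum_inl_inr_le_sum` ∕ `abs_pushSum_inr_inl_le_sum`.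
§2 **`sum_abs_pushSum_inl_inr_le`** ∕ **`sum_abs_pushSum_inr_inl_le`**: if the multiplier-leg mass of `K` at the field site `x` over EVERY finite set is
   `≤ B`, the same mass of `pushSum M L K` is `≤ L · B` (fibres of the map `(W′, i′) ↦ M • legPt L (inl μ) W′ i′` have `≤ L` elements —
   `Finset.sum_comp` + the fibre lemma).
§3 **`sum_abs_pushSum_borderInc_inl_inr_le`** ∕ **`sum_abs_pushSum_borderInc_inr_inl_le`**: the announced `mass_pushSum_borderInc_le` in both
   off-diagonal blocks, `≤ L · ((2R_V+1)^{d+1} · (M · 3ℓ² ∕ M^{d+1}))`, `R_V = 2(d+1)(Lc+1) + 2d + 3`; and the support of the pushed increment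
   `pushSum_borderInc_ne_zero` (field leg within `R_V·M`, multiplier leg within `R_V·M + 2(d+1)·M′·L` of `u`, `M′` the push's base scale).
-/

noncomputable section

open Finset
open scoped BigOperators
open Literature.MathematicalPhysics.QuantumFieldTheory
open Literature.MathematicalPhysics.QuantumFieldTheory.Balaban1983to89
open Literature.MathematicalPhysics.QuantumFieldTheory.Balaban1983to89.Beta
open Literature.Probability.LatticeModels (Torus.proj Torus.proj_apply)
open LatticeForm (quo)
open B12Sec2to5 (l1 l1_nonneg)
open ExpKernelCalculus (MKer l1_natSmul l1_sub_triangle l1_sub_symm)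
open OneStepResolventKernel (Fib eq_zsmul_quo_of_proj quo_zsmul proj_zsmul)
open OneStepKernelFamily (LegIdx legSet legPt legW)
open InterLevelTransport (legOff legPt_eq_add_legOff)
open AveragingHessianKernels (ell)
open BalabanCompositeJets (pushSum pushSet pushPt pushInd borderInc)
open Summit.QuantumFields.BalabanUV.Beta.GAN24.PushSumNest (mem_LegIdx_iff pushSum_inr_of_proj_ne pushSum_inr_of_proj_ne')
open Summit.QuantumFields.BalabanUV.Beta.GAN24.TaylorMassLam (card_filter_proj_legOff_le l1_legOff_le)
open Summit.QuantumFields.BalabanUV.Beta.GAN24.TaylorMassVH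

namespace Summit.QuantumFields.BalabanUV.Beta.GAN24.TaylorMassVHPush

variable {d : ℕ}

/-! ## §1 The pushed multiplier leg as a sum over the block's straight contours; fibres of the contour map -/

section Push

variable (M L : ℕ)

/-- [folklore] A contour point determines the block's base point from the index: `legPt L (inl μ) W′ i′ = p ↔ p − legOff L (inl μ) i′ = L•W′`. -/
theorem legPt_eq_iff (μ : Fin (d + 1)) (W' p : Fin (d + 1) → ℤ) (i' : (Fin (d + 1) → ℕ) × ℕ) :
    legPt L (Sum.inl μ : Fib d) W' i' = p ↔ p - legOff L (Sum.inl μ : Fib d) i' = (L : ℤ) • W' := by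
  rw [legPt_eq_add_legOff]
  constructor
  · intro h; rw [← h]; abel
  · intro h; exact (sub_eq_iff_eq_add.mp h).symm

/-- [folklore] **THE CONTOUR FIBRE LEMMA**: at most `L` contour indices of `LegIdx d L` have a given point as their contour point over a given block
(the offset must be congruent to the point mod `L`: `TaylorMassLam.card_filter_proj_legOff_le`). -/
theorem card_filter_legPt_eq_le (μ : Fin (d + 1)) (W' p : Fin (d + 1) → ℤ) :
    ((LegIdx d L).filter fun i' => legPt L (Sum.inl μ : Fib d) W' i' = p).card ≤ L := by
  refine le_trans (Finset.card_le_card ?_) (card_filter_proj_legOff_le L μ p)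
  intro i' hi'
  rw [Finset.mem_filter] at hi' ⊢
  refine ⟨hi'.1, ?_⟩
  rw [(legPt_eq_iff L μ W' p i').1 hi'.2]
  exact proj_zsmul _

variable [NeZero M] [NeZero L]

/-- [folklore] At a new coarse point `(M·L)•W′`, the pushed (field, multiplier) entry is the sum over the `L^{d+2}` contour indices of the old entries
at the `M`-images of the contour points (fine form of `PushSumNest.pushSum_inl_inr_coarse`). -/
theorem pushSum_inl_inr_coarse_sum (K : MKer (d + 1) (Fib d)) (x W' : Fin (d + 1) → ℤ) (α μ : Fin (d + 1)) :
    pushSum M L K x (((M * L : ℕ) : ℤ) • W') (Sum.inl α) (Sum.inr μ) =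
      ∑ i' ∈ LegIdx d L, K x ((M : ℤ) • legPt L (Sum.inl μ : Fib d) W' i') (Sum.inl α) (Sum.inr μ) := by
  simp only [pushSum, pushInd, pushSet, pushPt, legSet, proj_zsmul, quo_zsmul, if_true, one_mul, Finset.sum_singleton]

/-- [folklore] The transposed entry (multiplier, field). -/
theorem pushSum_inr_inl_coarse_sum (K : MKer (d + 1) (Fib d)) (W' w : Fin (d + 1) → ℤ) (μ α : Fin (d + 1)) :
    pushSum M L K (((M * L : ℕ) : ℤ) • W') w (Sum.inr μ) (Sum.inl α) =
      ∑ i ∈ LegIdx d L, K ((M : ℤ) • legPt L (Sum.inl μ : Fib d) W' i) w (Sum.inr μ) (Sum.inl α) := by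
  simp only [pushSum, pushInd, pushSet, pushPt, legSet, proj_zsmul, quo_zsmul, if_true, one_mul, Finset.sum_singleton]

end Push

/-! ## §2 Mass transfer through the push: the multiplier-leg mass grows by at most the factor `L` -/

section Transfer

variable (M L : ℕ) [NeZero M] [NeZero L]

/-- [folklore] The index pairs `(W′, i′)` whose `M`-dilated contour point is a given fine point number at most `L` (the dilation is injective and
`W′` is determined by `i′`). -/
theorem card_fibre_pair_le (μ : Fin (d + 1)) (A : Finset ((Fin (d + 1) → ℤ) × ((Fin (d + 1) → ℕ) × ℕ))) (hA : ∀ a ∈ A, a.2 ∈ LegIdx d L)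
    (z : Fin (d + 1) → ℤ) :
    (A.filter fun a => (M : ℤ) • legPt L (Sum.inl μ : Fib d) a.1 a.2 = z).card ≤ L := by
  classical
  by_cases hne : (A.filter fun a => (M : ℤ) • legPt L (Sum.inl μ : Fib d) a.1 a.2 = z) = ∅
  · rw [hne, Finset.card_empty]; exact Nat.zero_le _
  obtain ⟨a₀, ha₀⟩ := Finset.nonempty_iff_ne_empty.2 hne
  rw [Finset.mem_filter] at ha₀
  set p : Fin (d + 1) → ℤ := legPt L (Sum.inl μ : Fib d) a₀.1 a₀.2 with hp
  have hM : (M : ℤ) ≠ 0 := by exact_mod_cast NeZero.ne M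
  -- every member of the fibre has contour point `p`
  have hmem : ∀ a ∈ A.filter (fun a => (M : ℤ) • legPt L (Sum.inl μ : Fib d) a.1 a.2 = z), legPt L (Sum.inl μ : Fib d) a.1 a.2 = p := by
    intro a ha
    rw [Finset.mem_filter] at ha
    have e : (M : ℤ) • legPt L (Sum.inl μ : Fib d) a.1 a.2 = (M : ℤ) • p := by rw [ha.2, hp, ha₀.2]
    exact smul_right_injective (Fin (d + 1) → ℤ) hM e
  refine le_trans ?_ (card_filter_proj_legOff_le L μ p)
  refine Finset.card_le_card_of_injOn Prod.snd (fun a ha => ?_) (fun a ha a' ha' h2 => ?_)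
  · have ha' := Finset.mem_coe.1 ha
    refine Finset.mem_coe.2 (Finset.mem_filter.2 ⟨hA a (Finset.mem_filter.1 ha').1, ?_⟩)
    rw [(legPt_eq_iff L μ a.1 p a.2).1 (hmem a ha')]
    exact proj_zsmul _
  · have e1 := (legPt_eq_iff L μ a.1 p a.2).1 (hmem a (Finset.mem_coe.1 ha))
    have e2 := (legPt_eq_iff L μ a'.1 p a'.2).1 (hmem a' (Finset.mem_coe.1 ha'))
    have hL : (L : ℤ) ≠ 0 := by exact_mod_cast NeZero.ne L
    have h1 : (L : ℤ) • a.1 = (L : ℤ) • a'.1 := by rw [← e1, ← e2, h2]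
    exact Prod.ext (smul_right_injective (Fin (d + 1) → ℤ) hL h1) h2

/-- [folklore] **MASS TRANSFER, (field, multiplier) block**: if `Σ_{z ∈ Z} |K x z (inl α) (inr μ)| ≤ B` for every finite `Z`, then for every finite `T`
`Σ_{y ∈ T} |pushSum M L K x y (inl α) (inr μ)| ≤ L · B`. -/
theorem sum_abs_pushSum_inl_inr_le (K : MKer (d + 1) (Fib d)) (x : Fin (d + 1) → ℤ) (α μ : Fin (d + 1)) {B : ℝ}
    (hB : ∀ Z : Finset (Fin (d + 1) → ℤ), ∑ z ∈ Z, |K x z (Sum.inl α) (Sum.inr μ)| ≤ B) (T : Finset (Fin (d + 1) → ℤ)) :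
    ∑ y ∈ T, |pushSum M L K x y (Sum.inl α) (Sum.inr μ)| ≤ (L : ℝ) * B := by
  classical
  have hB0 : 0 ≤ B := le_trans (by simp) (hB ∅)
  -- drop the points off the new coarse lattice
  set T' := T.filter fun y => Torus.proj (M * L) y = 0 with hT'
  have hsub : T' ⊆ T := Finset.filter_subset _ _
  have hvan : ∀ y ∈ T, y ∉ T' → |pushSum M L K x y (Sum.inl α) (Sum.inr μ)| = 0 := by
    intro y hy hy'
    have hproj : Torus.proj (M * L) y ≠ 0 := fun h => hy' (Finset.mem_filter.2 ⟨hy, h⟩)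
    rw [pushSum_inr_of_proj_ne' M L hproj, abs_zero]
  rw [← Finset.sum_subset hsub hvan]
  -- re-index by the new block `W′ = quo (M·L) y` and expand the push
  set A : Finset ((Fin (d + 1) → ℤ) × ((Fin (d + 1) → ℕ) × ℕ)) := (T'.image (quo (M * L))) ×ˢ LegIdx d L with hAdef
  set g : (Fin (d + 1) → ℤ) → ℝ := fun z => |K x z (Sum.inl α) (Sum.inr μ)| with hg
  set f : (Fin (d + 1) → ℤ) × ((Fin (d + 1) → ℕ) × ℕ) → (Fin (d + 1) → ℤ) := fun a => (M : ℤ) • legPt L (Sum.inl μ : Fib d) a.1 a.2 with hf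
  have step1 : ∑ y ∈ T', |pushSum M L K x y (Sum.inl α) (Sum.inr μ)| ≤ ∑ a ∈ A, g (f a) := by
    have hinj : Set.InjOn (quo (M * L)) (T' : Set (Fin (d + 1) → ℤ)) := by
      intro y hy y' hy' hq
      rw [Finset.coe_filter] at hy hy'
      rw [eq_zsmul_quo_of_proj (N := M * L) hy.2, eq_zsmul_quo_of_proj (N := M * L) hy'.2, hq]
    rw [hAdef, Finset.sum_product, Finset.sum_image hinj]
    refine Finset.sum_le_sum fun y hy => ?_
    rw [Finset.mem_filter] at hy
    have ey := eq_zsmul_quo_of_proj (N := M * L) hy.2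
    rw [ey, pushSum_inl_inr_coarse_sum, quo_zsmul]
    exact Finset.abs_sum_le_sum_abs _ _
  refine step1.trans ?_
  -- fibrewise: each fine point is hit at most `L` times
  rw [Finset.sum_comp]
  have hA : ∀ a ∈ A, a.2 ∈ LegIdx d L := fun a ha => (Finset.mem_product.1 ha).2
  calc ∑ z ∈ A.image f, ((A.filter fun a => f a = z).card : ℕ) • g z
      ≤ ∑ z ∈ A.image f, (L : ℝ) * g z := by
        refine Finset.sum_le_sum fun z _ => ?_
        rw [nsmul_eq_mul]
        refine mul_le_mul_of_nonneg_right ?_ (abs_nonneg _)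
        exact_mod_cast card_fibre_pair_le M L μ A hA z
    _ = (L : ℝ) * ∑ z ∈ A.image f, g z := by rw [Finset.mul_sum]
    _ ≤ (L : ℝ) * B := mul_le_mul_of_nonneg_left (hB _) (Nat.cast_nonneg L)

/-- [folklore] **MASS TRANSFER, (multiplier, field) block** (the transposed statement, summing over the first leg at a fixed field site `w`). -/
theorem sum_abs_pushSum_inr_inl_le (K : MKer (d + 1) (Fib d)) (w : Fin (d + 1) → ℤ) (μ α : Fin (d + 1)) {B : ℝ}
    (hB : ∀ Z : Finset (Fin (d + 1) → ℤ), ∑ z ∈ Z, |K z w (Sum.inr μ) (Sum.inl α)| ≤ B) (S : Finset (Fin (d + 1) → ℤ)) :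
    ∑ x ∈ S, |pushSum M L K x w (Sum.inr μ) (Sum.inl α)| ≤ (L : ℝ) * B := by
  classical
  have hB0 : 0 ≤ B := le_trans (by simp) (hB ∅)
  set S' := S.filter fun x => Torus.proj (M * L) x = 0 with hS'
  have hsub : S' ⊆ S := Finset.filter_subset _ _
  have hvan : ∀ x ∈ S, x ∉ S' → |pushSum M L K x w (Sum.inr μ) (Sum.inl α)| = 0 := by
    intro x hx hx'
    have hproj : Torus.proj (M * L) x ≠ 0 := fun h => hx' (Finset.mem_filter.2 ⟨hx, h⟩)
    rw [pushSum_inr_of_proj_ne M L hproj, abs_zero]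
  rw [← Finset.sum_subset hsub hvan]
  set A : Finset ((Fin (d + 1) → ℤ) × ((Fin (d + 1) → ℕ) × ℕ)) := (S'.image (quo (M * L))) ×ˢ LegIdx d L with hAdef
  set g : (Fin (d + 1) → ℤ) → ℝ := fun z => |K z w (Sum.inr μ) (Sum.inl α)| with hg
  set f : (Fin (d + 1) → ℤ) × ((Fin (d + 1) → ℕ) × ℕ) → (Fin (d + 1) → ℤ) := fun a => (M : ℤ) • legPt L (Sum.inl μ : Fib d) a.1 a.2 with hf
  have step1 : ∑ x ∈ S', |pushSum M L K x w (Sum.inr μ) (Sum.inl α)| ≤ ∑ a ∈ A, g (f a) := by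
    have hinj : Set.InjOn (quo (M * L)) (S' : Set (Fin (d + 1) → ℤ)) := by
      intro y hy y' hy' hq
      rw [Finset.coe_filter] at hy hy'
      rw [eq_zsmul_quo_of_proj (N := M * L) hy.2, eq_zsmul_quo_of_proj (N := M * L) hy'.2, hq]
    rw [hAdef, Finset.sum_product, Finset.sum_image hinj]
    refine Finset.sum_le_sum fun x hx => ?_
    rw [Finset.mem_filter] at hx
    have ex := eq_zsmul_quo_of_proj (N := M * L) hx.2
    rw [ex, pushSum_inr_inl_coarse_sum, quo_zsmul]
    exact Finset.abs_sum_le_sum_abs _ _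
  refine step1.trans ?_
  rw [Finset.sum_comp]
  have hA : ∀ a ∈ A, a.2 ∈ LegIdx d L := fun a ha => (Finset.mem_product.1 ha).2
  calc ∑ z ∈ A.image f, ((A.filter fun a => f a = z).card : ℕ) • g z
      ≤ ∑ z ∈ A.image f, (L : ℝ) * g z := by
        refine Finset.sum_le_sum fun z _ => ?_
        rw [nsmul_eq_mul]
        refine mul_le_mul_of_nonneg_right ?_ (abs_nonneg _)
        exact_mod_cast card_fibre_pair_le M L μ A hA z
    _ = (L : ℝ) * ∑ z ∈ A.image f, g z := by rw [Finset.mul_sum]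
    _ ≤ (L : ℝ) * B := mul_le_mul_of_nonneg_left (hB _) (Nat.cast_nonneg L)

end Transfer

/-! ## §3 The pushed border increment (leaf VH1 proper) -/

section Pushed

variable {Lc : ℕ} (M L : ℕ) [NeZero M] [NeZero L] [NeZero Lc]

/-- [folklore] **VH1, MASS — `mass_pushSum_borderInc_le`, (field, multiplier) block**: for every fine bond `(κ, u)`, field site `x` and finite `T`,
`Σ_{y ∈ T} |pushSum (M·Lc) L (borderInc d Lc M κ u) x y (inl α) (inr μ)| ≤ L · (2R_V+1)^{d+1} · (M · 3ℓ² ∕ M^{d+1})`, `R_V = 2(d+1)(Lc+1)+2d+3`: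
«path length `L`» × «coarse points in range» × «`M` contour terms of a lifted unit-mass table». -/
theorem sum_abs_pushSum_borderInc_inl_inr_le (hL : 1 ≤ Lc) (κ : Fin (d + 1)) (u x : Fin (d + 1) → ℤ) (α μ : Fin (d + 1))
    (T : Finset (Fin (d + 1) → ℤ)) :
    ∑ y ∈ T, |pushSum (M * Lc) L (borderInc d Lc M κ u) x y (Sum.inl α) (Sum.inr μ)| ≤
      (L : ℝ) * (((2 * (2 * (d + 1) * (Lc + 1) + (2 * d + 3)) + 1) ^ (d + 1) : ℕ) *
        ((M : ℝ) * (3 * (ell (d + 1) Lc : ℝ) ^ 2 / (M : ℝ) ^ (d + 1)))) :=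
  sum_abs_pushSum_inl_inr_le (M * Lc) L _ x α μ (fun Z => sum_abs_borderInc_inl_inr_le M hL κ u x α μ Z) T

/-- [folklore] **VH1, MASS — (multiplier, field) block** (sum over the first leg at a fixed field site `w`). -/
theorem sum_abs_pushSum_borderInc_inr_inl_le (hL : 1 ≤ Lc) (κ : Fin (d + 1)) (u w : Fin (d + 1) → ℤ) (μ α : Fin (d + 1))
    (S : Finset (Fin (d + 1) → ℤ)) :
    ∑ x ∈ S, |pushSum (M * Lc) L (borderInc d Lc M κ u) x w (Sum.inr μ) (Sum.inl α)| ≤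
      (L : ℝ) * (((2 * (2 * (d + 1) * (Lc + 1) + (2 * d + 3)) + 1) ^ (d + 1) : ℕ) *
        ((M : ℝ) * (3 * (ell (d + 1) Lc : ℝ) ^ 2 / (M : ℝ) ^ (d + 1)))) :=
  sum_abs_pushSum_inr_inl_le (M * Lc) L _ w μ α (fun Z => sum_abs_borderInc_inr_inl_le M hL κ u w μ α Z) S

/-- [folklore] **VH1, SUPPORT OF THE PUSHED INCREMENT, (field, multiplier) block**: a nonzero entry has its field leg within `R_V·M` of `u` and its
multiplier leg (a point of the new coarse lattice `(M·Lc·L)•ℤ^{d+1}`) within `R_V·M + 2(d+1)·(M·Lc)·L` of `u`. -/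
theorem pushSum_borderInc_inl_inr_ne_zero (hL : 1 ≤ Lc) {κ : Fin (d + 1)} {u x y : Fin (d + 1) → ℤ} {α μ : Fin (d + 1)}
    (h : pushSum (M * Lc) L (borderInc d Lc M κ u) x y (Sum.inl α) (Sum.inr μ) ≠ 0) :
    Torus.proj (M * Lc * L) y = 0 ∧ l1 (x - u) ≤ ((2 * (d + 1) * (Lc + 1) + (2 * d + 3)) * M : ℕ) ∧
      l1 (y - u) ≤ ((2 * (d + 1) * (Lc + 1) + (2 * d + 3)) * M : ℕ) + 2 * ((d : ℝ) + 1) * L * (M * Lc : ℕ) := by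
  have hproj : Torus.proj (M * Lc * L) y = 0 := by
    by_contra hne; exact h (pushSum_inr_of_proj_ne' (M * Lc) L hne _ x _ μ)
  refine ⟨hproj, ?_⟩
  have ey := eq_zsmul_quo_of_proj (N := M * Lc * L) hproj
  rw [ey, pushSum_inl_inr_coarse_sum] at h
  obtain ⟨i', hi', hne⟩ := Finset.exists_ne_zero_of_sum_ne_zero h
  obtain ⟨hx, hz⟩ := borderInc_ne_zero M hL hne
  refine ⟨hx, ?_⟩
  -- the new coarse point is within `2(d+1)L` (in `M·Lc`-units) of the contour point
  set W' := quo (M * Lc * L) y with hW'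
  have hoff : l1 (legPt L (Sum.inl μ : Fib d) W' i' - (L : ℤ) • W') ≤ 2 * (d + 1) * L :=
    OneStepKernelFamily.l1_legPt_sub_le L (Sum.inl μ : Fib d) W' hi'
  have e1 : (((M * Lc * L : ℕ) : ℤ)) • W' = ((M * Lc : ℕ) : ℤ) • ((L : ℤ) • W') := by rw [smul_smul]; push_cast; ring_nf
  have hdist : l1 ((((M * Lc * L : ℕ) : ℤ)) • W' - ((M * Lc : ℕ) : ℤ) • legPt L (Sum.inl μ : Fib d) W' i') ≤ 2 * ((d : ℝ) + 1) * L * (M * Lc : ℕ) := by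
    rw [e1, ← smul_sub, l1_natSmul, l1_sub_symm]
    have hMLc : (0 : ℝ) ≤ (M * Lc : ℕ) := Nat.cast_nonneg _
    calc ((M * Lc : ℕ) : ℝ) * l1 (legPt L (Sum.inl μ : Fib d) W' i' - (L : ℤ) • W') ≤ ((M * Lc : ℕ) : ℝ) * (2 * (d + 1) * L) :=
          mul_le_mul_of_nonneg_left hoff hMLc
      _ = 2 * ((d : ℝ) + 1) * L * (M * Lc : ℕ) := by ring
  rw [← ey] at hdist
  have tri := l1_sub_triangle y (((M * Lc : ℕ) : ℤ) • legPt L (Sum.inl μ : Fib d) W' i') u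
  linarith

end Pushed

end Summit.QuantumFields.BalabanUV.Beta.GAN24.TaylorMassVHPush

end
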